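import Mathlib

/-!
# `k`-th powers in a finite cyclic group

Solo-blind programme (Langlands seat), side result used in the 2-adic Eisenstein depth law at level `2N`:
the dictionary `2 ∈ (ℤ/N)ˣ ^ (2^s) ↔ v₂(ord_N 2) ≤ v₂(N-1) - s` is the case `G = (ZMod N)ˣ`, `k = 2^s`
of the elementary criterion below: in a finite cyclic group of order `n`, an element `x` is a `k`-th power
iff `x ^ (n / gcd n k) = 1`, i.e. iff `orderOf x ∣ n / gcd n k`.
-/

set_option autoImplicit false
set_option linter.dupNamespace false

namespace Summit.Langlands.Langlands.Theorems.SoloBlindCyclicPowers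

/-- In a finite cyclic group of order `n`, `x` is a `k`-th power iff `x ^ (n / gcd n k) = 1`. -/
theorem exists_pow_eq_iff_pow_div_gcd_eq_one {G : Type*} [CommGroup G] [Fintype G] [IsCyclic G]
    (x : G) (k : ℕ) :
    (∃ y : G, y ^ k = x) ↔ x ^ (Fintype.card G / Nat.gcd (Fintype.card G) k) = 1 := by
  classical
  set n := Fintype.card G with hn_def
  set d := Nat.gcd n k with hd_def
  have hn : 0 < n := Fintype.card_pos
  have hdn : d ∣ n := Nat.gcd_dvd_left n k
  have hdk : d ∣ k := Nat.gcd_dvd_right n k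
  have hd : 0 < d := Nat.gcd_pos_of_pos_left k hn
  have hnd : d * (n / d) = n := Nat.mul_div_cancel' hdn
  have hq : 0 < n / d := Nat.div_pos (Nat.le_of_dvd hn hdn) hd
  constructor
  · rintro ⟨y, rfl⟩
    rw [← pow_mul]
    have hkn : k * (n / d) = n * (k / d) := by
      rw [← Nat.mul_div_assoc k hdn, ← Nat.mul_div_assoc n hdk, mul_comm]
    rw [hkn, pow_mul, pow_card_eq_one, one_pow]
  · intro hx
    obtain ⟨g, hg⟩ := IsCyclic.exists_monoid_generator (α := G)
    obtain ⟨a, rfl⟩ := (Submonoid.mem_powers_iff _ _).mp (hg x)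
    have hzg : ∀ z : G, z ∈ Subgroup.zpowers g := fun z => by
      obtain ⟨m, rfl⟩ := (Submonoid.mem_powers_iff _ _).mp (hg z)
      exact ⟨m, zpow_natCast g m⟩
    have hog : orderOf g = n := by
      rw [orderOf_eq_card_of_forall_mem_zpowers hzg, Nat.card_eq_fintype_card]
    -- from `g ^ (a * (n/d)) = 1` get `d ∣ a`
    have hda : d ∣ a := by
      rw [← pow_mul] at hx
      have h1 : orderOf g ∣ a * (n / d) := orderOf_dvd_of_pow_eq_one hx
      rw [hog] at h1
      have h2 : d * (n / d) ∣ a * (n / d) := by rwa [hnd]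
      exact Nat.dvd_of_mul_dvd_mul_right hq h2
    obtain ⟨a', rfl⟩ := hda
    -- Bézout: d = n * A + k * B over ℤ, so g ^ (d * a') = (g ^ (B * a')) ^ k
    have hbez : ((d * a' : ℕ) : ℤ) = (n : ℤ) * (Nat.gcdA n k * a') + Nat.gcdB n k * a' * k := by
      have := Nat.gcd_eq_gcd_ab n k
      rw [← hd_def] at this
      push_cast
      rw [this]
      ring
    have hgn : g ^ (n : ℤ) = 1 := by
      rw [zpow_natCast, hn_def]
      exact pow_card_eq_one
    have key : g ^ ((d * a' : ℕ) : ℤ) = (g ^ ((Nat.gcdB n k * a' : ℤ))) ^ (k : ℤ) := by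
      rw [hbez, zpow_add, zpow_mul g (n : ℤ) (Nat.gcdA n k * a'), hgn, one_zpow, one_mul,
        zpow_mul g (Nat.gcdB n k * a') (k : ℤ)]
    refine ⟨g ^ ((Nat.gcdB n k * a' : ℤ)), ?_⟩
    rw [← zpow_natCast g (d * a'), key, zpow_natCast]

/-- Special case `k ∣ n`: `x` is a `k`-th power iff `x ^ (n / k) = 1`. -/
theorem exists_pow_eq_iff_pow_div_eq_one {G : Type*} [CommGroup G] [Fintype G] [IsCyclic G]
    (x : G) {k : ℕ} (hk : k ∣ Fintype.card G) :
    (∃ y : G, y ^ k = x) ↔ x ^ (Fintype.card G / k) = 1 := by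
  have h := exists_pow_eq_iff_pow_div_gcd_eq_one x k
  rwa [Nat.gcd_eq_right hk] at h

/-- Order form: `x` is a `k`-th power iff `orderOf x ∣ n / gcd n k`. -/
theorem exists_pow_eq_iff_orderOf_dvd {G : Type*} [CommGroup G] [Fintype G] [IsCyclic G]
    (x : G) (k : ℕ) :
    (∃ y : G, y ^ k = x) ↔ orderOf x ∣ Fintype.card G / Nat.gcd (Fintype.card G) k := by
  rw [exists_pow_eq_iff_pow_div_gcd_eq_one, orderOf_dvd_iff_pow_eq_one]

end Summit.Langlands.Langlands.Theorems.SoloBlindCyclicPowers
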